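import Literature.AnabelianGeometry.EtaleTheta.Discharge.Sec2Cor216Cor218ivOddAtModelTate
import Literature.AnabelianGeometry.EtaleTheta.Discharge.Sec2Cor218ivAllLevels
import Literature.AnabelianGeometry.EtaleTheta.Discharge.Sec2Cor219iAtModelChi
import Literature.AnabelianGeometry.EtaleTheta.Discharge.Sec2Cor218ivCor219iiLabelFree
import HarnessLib

/-!
# The remaining [EtTh] §2 `RigidData` / `ThetaEnvData` rows AT THE TATE INSTANCE FOR THE DATUM OF RECORD —
# Prop. 2.14 (ii), Cor. 2.18 (ii), Cor. 2.18 (iv) surjectivity / fibre (`ThetaEnvData` currency), and the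
# «induces» clause of Prop. 2.14 (iii) — with Prop. 1.5 (ii), (iii) DISCHARGED (proof-only capstone;
# FROZEN FACT-LIST rows F-0632, F-0621, F-0635, F-0625, F-0639, F-0638, F-0628)

Mochizuki, *The Étale Theta Function and its Frobenioid-theoretic Manifestations* [EtTh], Publ. RIMS **45**
(2009), §2: Prop. 2.14 (ii) PDF p. 49, (iii) pp. 49–50, Cor. 2.18 (ii) p. 60, (iv) p. 61; §1 Prop. 1.5 (ii), (iii)
p. 23 (locators `p.N` = PDF pages of the PRIMS text; bib key `MochizukiEtTh2009`) [cite: MochizukiEtTh2009, Cor 2.18 (iv) p.61].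
Cell `abc-iut`, block F, seat abc-iut-f-153 (gen 5; [EtTh] §2 L-F census pack «LF-ETTH-S2», riding BY NAME on the
tranche-147…154 rows).  PROOF-ONLY: no definition, no instance, no notation, no new named fact; every input BY NAME.

STATE OF RECORD.  At the stage-2 record `ThetaSetting.modelχq p i j hj` abc-iut-f-149's `Sec2RigidityAtModelTate`
proves Prop. 2.14 (ii) (F-0632) and Cor. 2.18 (ii) (F-0621) modulo Prop. 1.5 (ii), (iii) (`h15ii`, `h15`), and
abc-iut-L2-t8's `SettingModelTateRigidityOfRecord(Closed)` closes EIGHT `RigidData` rows at the section data of the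
Tate instance with `h15` discharged — but not these two, nor the `ThetaEnvData`-currency Cor. 2.18 (ii) (F-0635) /
(iv)-fibre (F-0638) / (iv)-surjectivity (F-0639 / F-0625), nor the «induces» clause `RigidData.Induces` (F-0628,
abc-iut-f-147's `exists_induces_modelχq`, `h15`-bound).  At the Tate instance `modelχq p 1 2` Prop. 1.5 (ii) AND
(iii) are THEOREMS for abc-iut-w5-d171's étale-theta datum of record `etaleThetaDataχqInr p`
(`prop15ii_etaleThetaDataχqInr`, `prop15iii_etaleThetaDataχqInr`).  Hence, for every `X̲̲`-choice `C` over that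
datum, every level `μ` / tower `τ`, every cusp labelling `L`:

* §1 BINDER-FREE (data only): F-0632 `prop214_ii_modelTate_inr`, F-0621 `cor218_ii_modelTate_inr`, F-0635
  `thetaEnvData_cor218_ii_modelTate_inr_modAll` (every `M ∈ ℕ≥1`) / `thetaEnvTower_level_cor218_ii_modelTate_inr`
  (every chain level), F-0638 `thetaEnvData_cor218_iv_fibre_modelTate_inr`, F-0628 `exists_induces_modelTate_inr`
  (every continuous automorphism of the model mono-theta environment induces an automorphism of `Π^tp_Y̲̲`);
* §2 modulo the two §2 RIGIDITY facts ONLY (Cor. 2.18 (i) at the chain levels, `ThetaEnvTower.Cor219_iii`):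
  F-0625 `rigidData_cor218_iv_surjective_modAll_modelTate_inr_of_rigidity` and F-0639
  `thetaEnvData_cor218_iv_surjective_modAll_modelTate_inr_of_rigidity` (every `M ∈ ℕ≥1`) — the level-wise lifting
  clause that `cor219_ii_modelTate_inr_of_lift` (this seat, p454435) consumes as `hlift`;
* §3 census conjunction `sec2_rigid_rows_modelTate_inr`.

HONEST LABEL: `modelχq` is a SEMI-SYNTHETIC model of the typed §1 interface (the Tate-sheared χ-twisted root; not the
tempered `π₁` of a curve) — consistency / joint-satisfiability evidence and the kernel record that these FACT rows are
THEOREMS at that inhabitant (binder-free, resp. modulo the two named rigidity rows); nothing of [EtTh] (refereed) is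
asserted; no side is taken on [IUTchIII] Cor. 3.12; typed ≠ proved; a FACT row is an assumption label, not an endorsement.
-/

noncomputable section

namespace Literature.AnabelianGeometry.EtaleTheta.SettingModel

open Literature.AnabelianGeometry.SemiGraphs
open Literature.AlgebraicGeometry.Frobenioids (IsSlimGroup)

variable (p : ℕ) [Fact p.Prime]
variable {l : ℕ} (C : (etaleThetaDataχqInr p).DoubleUnderline l) {N : ℕ+}
  (μ : (ThetaSetting.modelχq p 1 2 even_two).CyclotomeMod l N) {Es : Set ℕ+}
  (τ : (ThetaSetting.modelχq p 1 2 even_two).CyclotomeTower l Es)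

/-! ## §1. Binder-free rows at the datum of record -/

/-- **F-0632 [EtTh] Prop. 2.14 (ii) for the rigidity data of the datum OF RECORD at the Tate instance — NO `Prop`
binder** («`δ` extends to a cocycle of `Π^tp_Y` … `α_δ` preserves `D_Y`»): abc-iut-f-149's `rigidData_prop214_ii_modelχq`
with `h15`, `h15ii` := abc-iut-w5-d171's theorems; binders = data `C`, `μ`, `L`. [cite: MochizukiEtTh2009, Prop 2.14 (ii) p.49] -/
theorem prop214_ii_modelTate_inr (L : C.CuspLabels) :
    Literature.AnabelianGeometry.EtaleTheta.RigidData.Prop214_ii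
      (C.rigidData μ (compat_modelχq p 1 2 even_two) (ThetaSetting.modelχq_sec2Hyps p 1 2 even_two)
        (prop15iii_etaleThetaDataχqInr p _) L) :=
  rigidData_prop214_ii_modelχq p 1 2 even_two C μ _ _ _ (prop15ii_etaleThetaDataχqInr p _) L

/-- **F-0621 [EtTh] Cor. 2.18 (ii) for the rigidity data of the datum OF RECORD at the Tate instance — NO `Prop`
binder** («precisely the content of Prop. 2.14 (ii)»): abc-iut-f-149's `rigidData_cor218_ii_modelχq` with `h15`,
`h15ii` discharged. [cite: MochizukiEtTh2009, Cor 2.18 (ii) p.60] -/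
theorem cor218_ii_modelTate_inr (L : C.CuspLabels) :
    Literature.AnabelianGeometry.EtaleTheta.RigidData.Cor218_ii
      (C.rigidData μ (compat_modelχq p 1 2 even_two) (ThetaSetting.modelχq_sec2Hyps p 1 2 even_two)
        (prop15iii_etaleThetaDataχqInr p _) L) :=
  rigidData_cor218_ii_modelχq p 1 2 even_two C μ _ _ _ (prop15ii_etaleThetaDataχqInr p _) L

/-- **F-0635 [EtTh] Cor. 2.18 (ii) in `ThetaEnvData` currency at EVERY level `M ∈ ℕ≥1` of the model of the datum OF
RECORD — NO `Prop` binder** (identification `τ.modAll M`): abc-iut-f-150's `thetaEnvData_cor218_ii_modAll` with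
Prop. 1.5 (ii), (iii) discharged. [cite: MochizukiEtTh2009, Cor 2.18 (ii) p.60] -/
theorem thetaEnvData_cor218_ii_modelTate_inr_modAll (M : ℕ+) :
    Literature.AnabelianGeometry.EtaleTheta.ThetaEnvData.Cor218_ii
      (C.thetaEnvData (τ.modAll M) (compat_modelχq p 1 2 even_two) (ThetaSetting.modelχq_sec2Hyps p 1 2 even_two)) :=
  C.thetaEnvData_cor218_ii_modAll τ _ _ (prop15iii_etaleThetaDataχqInr p _) (prop15ii_etaleThetaDataχqInr p _) M

/-- **F-0635 at every CHAIN level `M ∈ E` of the model tower of the datum OF RECORD — NO `Prop` binder.**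
[cite: MochizukiEtTh2009, Cor 2.18 (ii) p.60] -/
theorem thetaEnvTower_level_cor218_ii_modelTate_inr (M : Es) :
    Literature.AnabelianGeometry.EtaleTheta.ThetaEnvData.Cor218_ii
      ((C.thetaEnvTower τ (compat_modelχq p 1 2 even_two) (ThetaSetting.modelχq_sec2Hyps p 1 2 even_two)).level M) :=
  C.thetaEnvTower_level_cor218_ii τ _ _ (prop15iii_etaleThetaDataχqInr p _) (prop15ii_etaleThetaDataχqInr p _) M

/-- **F-0638 [EtTh] Cor. 2.18 (iv), fibre clause, in `ThetaEnvData` currency for the model of the datum OF RECORD at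
ANY level `μ` — NO `Prop` binder**: abc-iut-f-150's `thetaEnvData_cor218_iv_fibre_of_origin` with `h15` := abc-iut-w5-d171's
theorem and `IsEtThOrigin`, `hYcl` := abc-iut-L2-t5's `modelχq_isEtThOrigin`, `hYcl_modelχq`; binders = data `C`, `μ`, `L`.
[cite: MochizukiEtTh2009, Cor 2.18 (iv) p.61] -/
theorem thetaEnvData_cor218_iv_fibre_modelTate_inr (L : C.CuspLabels) :
    Literature.AnabelianGeometry.EtaleTheta.ThetaEnvData.Cor218_iv_fibre
      (C.thetaEnvData μ (compat_modelχq p 1 2 even_two) (ThetaSetting.modelχq_sec2Hyps p 1 2 even_two)) :=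
  C.thetaEnvData_cor218_iv_fibre_of_origin μ _ _ (prop15iii_etaleThetaDataχqInr p _) L
    (ThetaSetting.modelχq_isEtThOrigin p 1 2 even_two) (hYcl_modelχq p 1 2 even_two)

/-- **F-0628 the «induces» clause of [EtTh] Prop. 2.14 (iii) for the rigidity data of the datum OF RECORD — NO `Prop`
binder**: EVERY continuous automorphism `α` of the model mono-theta environment induces a topological automorphism of
`Π^tp_Y̲̲` (abc-iut-f-147's `exists_induces_modelχq`, via Cor. 2.18 (iii) from temp-slimness, with `h15` := abc-iut-w5-d171's
theorem). [cite: MochizukiEtTh2009, Prop 2.14 (iii) p.49] -/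
theorem exists_induces_modelTate_inr (L : C.CuspLabels)
    (α : MulAut (C.rigidData μ (compat_modelχq p 1 2 even_two) (ThetaSetting.modelχq_sec2Hyps p 1 2 even_two)
      (prop15iii_etaleThetaDataχqInr p _) L).env)
    (hα : α ∈ contMulAut (C.rigidData μ (compat_modelχq p 1 2 even_two)
      (ThetaSetting.modelχq_sec2Hyps p 1 2 even_two) (prop15iii_etaleThetaDataχqInr p _) L).env) :
    ∃ a : (C.rigidData μ (compat_modelχq p 1 2 even_two) (ThetaSetting.modelχq_sec2Hyps p 1 2 even_two)
          (prop15iii_etaleThetaDataχqInr p _) L).PiY ≃ₜ*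
        (C.rigidData μ (compat_modelχq p 1 2 even_two) (ThetaSetting.modelχq_sec2Hyps p 1 2 even_two)
          (prop15iii_etaleThetaDataχqInr p _) L).PiY,
      (C.rigidData μ (compat_modelχq p 1 2 even_two) (ThetaSetting.modelχq_sec2Hyps p 1 2 even_two)
        (prop15iii_etaleThetaDataχqInr p _) L).Induces α a :=
  exists_induces_modelχq p 1 2 even_two C μ _ _ _ L α hα

/-! ## §2. Cor. 2.18 (iv) surjectivity at every level, modulo the two §2 rigidity facts -/

/-- **F-0625 [EtTh] Cor. 2.18 (iv), surjectivity, for the rigidity data of the datum OF RECORD at EVERY level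
`M ∈ ℕ≥1`, modulo Cor. 2.18 (i) at the chain levels and `ThetaEnvTower.Cor219_iii` ONLY** («every automorphism of
`Π^tp_X̲̲` preserving `Π^tp_Y̲̲` lifts to `𝕄_M`»): abc-iut-f-150's `rigidData_cor218_iv_surjective_modAll` with Prop. 1.5 (ii), (iii)
discharged. [cite: MochizukiEtTh2009, Cor 2.18 (iv) p.61] -/
theorem rigidData_cor218_iv_surjective_modAll_modelTate_inr_of_rigidity (M : ℕ+) (L : C.CuspLabels)
    (h218i : ∀ e : Es, (C.rigidData (τ.mod e) (compat_modelχq p 1 2 even_two)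
      (ThetaSetting.modelχq_sec2Hyps p 1 2 even_two) (prop15iii_etaleThetaDataχqInr p _) L).Cor218_i)
    (h219iii : (C.thetaEnvTower τ (compat_modelχq p 1 2 even_two)
      (ThetaSetting.modelχq_sec2Hyps p 1 2 even_two)).Cor219_iii) :
    (C.rigidData (τ.modAll M) (compat_modelχq p 1 2 even_two) (ThetaSetting.modelχq_sec2Hyps p 1 2 even_two)
      (prop15iii_etaleThetaDataχqInr p _) L).Cor218_iv_surjective :=
  C.rigidData_cor218_iv_surjective_modAll τ M _ _ _ (prop15ii_etaleThetaDataχqInr p _) L h218i h219iii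

/-- **F-0639 the same in `ThetaEnvData` currency** (`Cor218_iv_surjective` of the level-`M` mono-theta environment of
the datum of record; the hypothesis `hsurj` of the [IUTchII] Prop. 1.5 model discharges of layer L6), modulo the two
rigidity facts ONLY. [cite: MochizukiEtTh2009, Cor 2.18 (iv) p.61] -/
theorem thetaEnvData_cor218_iv_surjective_modAll_modelTate_inr_of_rigidity (M : ℕ+) (L : C.CuspLabels)
    (h218i : ∀ e : Es, (C.rigidData (τ.mod e) (compat_modelχq p 1 2 even_two)
      (ThetaSetting.modelχq_sec2Hyps p 1 2 even_two) (prop15iii_etaleThetaDataχqInr p _) L).Cor218_i)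
    (h219iii : (C.thetaEnvTower τ (compat_modelχq p 1 2 even_two)
      (ThetaSetting.modelχq_sec2Hyps p 1 2 even_two)).Cor219_iii) :
    (C.thetaEnvData (τ.modAll M) (compat_modelχq p 1 2 even_two)
      (ThetaSetting.modelχq_sec2Hyps p 1 2 even_two)).Cor218_iv_surjective :=
  C.thetaEnvData_cor218_iv_surjective_modAll τ M _ _ (prop15iii_etaleThetaDataχqInr p _)
    (prop15ii_etaleThetaDataχqInr p _) L h218i h219iii

/-! ## §3. Census conjunction -/

/-- **THE §2 `RigidData`/`ThetaEnvData` ROWS OF THIS FILE AT THE DATUM OF RECORD** (Tate instance `modelχq p 1 2`,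
étale-theta datum `etaleThetaDataχqInr p`, every `X̲̲`-choice `C`, tower `τ`, level `M ∈ ℕ≥1`, cusp labelling `L`):
F-0632 ∧ F-0621 ∧ F-0635 ∧ F-0638 hold outright, and F-0625 / F-0639 hold given Cor. 2.18 (i) at the chain levels and
`ThetaEnvTower.Cor219_iii`. [cite: MochizukiEtTh2009, Cor 2.18 (iv) p.61] -/
theorem sec2_rigid_rows_modelTate_inr (M : ℕ+) (L : C.CuspLabels) :
    Literature.AnabelianGeometry.EtaleTheta.RigidData.Prop214_ii
        (C.rigidData (τ.modAll M) (compat_modelχq p 1 2 even_two) (ThetaSetting.modelχq_sec2Hyps p 1 2 even_two)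
          (prop15iii_etaleThetaDataχqInr p _) L) ∧
      Literature.AnabelianGeometry.EtaleTheta.RigidData.Cor218_ii
        (C.rigidData (τ.modAll M) (compat_modelχq p 1 2 even_two) (ThetaSetting.modelχq_sec2Hyps p 1 2 even_two)
          (prop15iii_etaleThetaDataχqInr p _) L) ∧
      Literature.AnabelianGeometry.EtaleTheta.ThetaEnvData.Cor218_ii
        (C.thetaEnvData (τ.modAll M) (compat_modelχq p 1 2 even_two) (ThetaSetting.modelχq_sec2Hyps p 1 2 even_two)) ∧
      Literature.AnabelianGeometry.EtaleTheta.ThetaEnvData.Cor218_iv_fibre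
        (C.thetaEnvData (τ.modAll M) (compat_modelχq p 1 2 even_two) (ThetaSetting.modelχq_sec2Hyps p 1 2 even_two)) ∧
      ((∀ e : Es, (C.rigidData (τ.mod e) (compat_modelχq p 1 2 even_two)
          (ThetaSetting.modelχq_sec2Hyps p 1 2 even_two) (prop15iii_etaleThetaDataχqInr p _) L).Cor218_i) →
        (C.thetaEnvTower τ (compat_modelχq p 1 2 even_two) (ThetaSetting.modelχq_sec2Hyps p 1 2 even_two)).Cor219_iii →
        (C.rigidData (τ.modAll M) (compat_modelχq p 1 2 even_two) (ThetaSetting.modelχq_sec2Hyps p 1 2 even_two)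
            (prop15iii_etaleThetaDataχqInr p _) L).Cor218_iv_surjective ∧
          (C.thetaEnvData (τ.modAll M) (compat_modelχq p 1 2 even_two)
            (ThetaSetting.modelχq_sec2Hyps p 1 2 even_two)).Cor218_iv_surjective) :=
  ⟨prop214_ii_modelTate_inr p C (τ.modAll M) L, cor218_ii_modelTate_inr p C (τ.modAll M) L,
    thetaEnvData_cor218_ii_modelTate_inr_modAll p C τ M, thetaEnvData_cor218_iv_fibre_modelTate_inr p C (τ.modAll M) L,
    fun h218i h219iii =>
      ⟨rigidData_cor218_iv_surjective_modAll_modelTate_inr_of_rigidity p C τ M L h218i h219iii,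
        thetaEnvData_cor218_iv_surjective_modAll_modelTate_inr_of_rigidity p C τ M L h218i h219iii⟩⟩

/-! ## §4. (v2 append) The LABEL-FREE residual: «every topological automorphism of `Π^tp_X̲̲` extends»

The binder `h218i : ∀ e, (C.rigidData (τ.mod e) …).Cor218_i` of §2 (and of this seat's p453594 / p454435) contains the
cusp-LABEL clause of Cor. 2.18 (i), which is UNSATISFIABLE at some labellings whenever `Π^tp_X` is temp-slim
(abc-iut-f-148's `exists_cuspLabels_not_cor218_i_of_slim`) — so `⟸ {h218i, h219iii}` is honest only at labellings
with conjugation-stable classes (e.g. the empty one).  abc-iut-f-148's `Sec2Cor218ivCor219iiLabelFree` re-cuts the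
lane-C2 capstones on the LABEL-FREE anabelian input
`hext : ∀ γ ∈ Aut_top(Π^tp_X̲̲), ∃ Γ ∈ Aut_top(Π^tp_X)` extending `γ` and stabilising `Δ^tp_X`, `Π^tp_Ÿ`
([EtTh] Cor. 2.18 (i) via [SemiAnbd] functoriality), which does not mention `L`.  Here: those forms AT THE DATUM OF
RECORD with Prop. 1.5 (ii)/(iii) and the four model-side binders discharged — residual = {`hext`, `ThetaEnvTower.Cor219_iii`}
for EVERY labelling `L` (the conclusions do not depend on `L`). -/

/-- **F-0625 at the datum of record, every level `M ∈ ℕ≥1`, modulo the LABEL-FREE residual {`hext`, `Cor219_iii`}**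
(abc-iut-f-148's `rigidData_cor218_iv_surjective_modAll_of_extends`, Prop. 1.5 (ii)/(iii) discharged).
[cite: MochizukiEtTh2009, Cor 2.18 (iv) p.61] -/
theorem rigidData_cor218_iv_surjective_modAll_modelTate_inr_of_extends (M : ℕ+) (L : C.CuspLabels)
    (hext : ∀ γ : ↥C.Huu ≃ₜ* ↥C.Huu, ∃ Γ : (ThetaSetting.modelχq p 1 2 even_two).PiTemp ≃ₜ*
        (ThetaSetting.modelχq p 1 2 even_two).PiTemp,
      (∀ h : C.Huu, Γ (h : (ThetaSetting.modelχq p 1 2 even_two).PiTemp) =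
        ((γ h : C.Huu) : (ThetaSetting.modelχq p 1 2 even_two).PiTemp)) ∧
      (ThetaSetting.modelχq p 1 2 even_two).DeltaTemp.map Γ.toMulEquiv.toMonoidHom =
        (ThetaSetting.modelχq p 1 2 even_two).DeltaTemp ∧
      (ThetaSetting.modelχq p 1 2 even_two).GtpYdd.map Γ.toMulEquiv.toMonoidHom =
        (ThetaSetting.modelχq p 1 2 even_two).GtpYdd)
    (h219iii : (C.thetaEnvTower τ (compat_modelχq p 1 2 even_two)
      (ThetaSetting.modelχq_sec2Hyps p 1 2 even_two)).Cor219_iii) :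
    (C.rigidData (τ.modAll M) (compat_modelχq p 1 2 even_two) (ThetaSetting.modelχq_sec2Hyps p 1 2 even_two)
      (prop15iii_etaleThetaDataχqInr p _) L).Cor218_iv_surjective :=
  C.rigidData_cor218_iv_surjective_modAll_of_extends τ M _ _ _ (prop15ii_etaleThetaDataχqInr p _) L hext h219iii

/-- **F-0649 Cor. 2.19 (ii) at the datum of record modulo the LABEL-FREE residual {`hext`, `Cor219_iii`}**
(abc-iut-f-148's `cor219_ii_model_of_extends_facts` with Prop. 1.5 (ii)/(iii), temp-slimness, `IsOpenMap aug`,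
`IsEtThOrigin`, `hYcl` ALL discharged). [cite: MochizukiEtTh2009, Cor 2.19 (ii) p.64] -/
theorem cor219_ii_modelTate_inr_of_extends (L : C.CuspLabels)
    (hext : ∀ γ : ↥C.Huu ≃ₜ* ↥C.Huu, ∃ Γ : (ThetaSetting.modelχq p 1 2 even_two).PiTemp ≃ₜ*
        (ThetaSetting.modelχq p 1 2 even_two).PiTemp,
      (∀ h : C.Huu, Γ (h : (ThetaSetting.modelχq p 1 2 even_two).PiTemp) =
        ((γ h : C.Huu) : (ThetaSetting.modelχq p 1 2 even_two).PiTemp)) ∧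
      (ThetaSetting.modelχq p 1 2 even_two).DeltaTemp.map Γ.toMulEquiv.toMonoidHom =
        (ThetaSetting.modelχq p 1 2 even_two).DeltaTemp ∧
      (ThetaSetting.modelχq p 1 2 even_two).GtpYdd.map Γ.toMulEquiv.toMonoidHom =
        (ThetaSetting.modelχq p 1 2 even_two).GtpYdd)
    (h219iii : (C.thetaEnvTower τ (compat_modelχq p 1 2 even_two)
      (ThetaSetting.modelχq_sec2Hyps p 1 2 even_two)).Cor219_iii) :
    (C.thetaEnvTower τ (compat_modelχq p 1 2 even_two) (ThetaSetting.modelχq_sec2Hyps p 1 2 even_two)).Cor219_ii :=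
  C.cor219_ii_model_of_extends_facts τ _ _ (prop15iii_etaleThetaDataχqInr p _) (prop15ii_etaleThetaDataχqInr p _) L
    (isSlimGroup_piTemp_modelχq p 1 2 even_two) (isOpenMap_aug_modelχq p 1 2 even_two) hext h219iii
    (ThetaSetting.modelχq_isEtThOrigin p 1 2 even_two) (hYcl_modelχq p 1 2 even_two)

/-- **F-0647 Cor. 2.18 (iv), odd bijectivity, at the datum of record modulo the LABEL-FREE residual {`hext`,
`Cor219_iii`}** (abc-iut-f-148's `cor218_iv_bijective_of_odd_of_model_of_core5_facts` ∘ `rigidData_core5_of_extends`,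
everything else discharged). [cite: MochizukiEtTh2009, Cor 2.18 (iv) p.62] -/
theorem cor218_iv_bijective_of_odd_modelTate_inr_of_extends (L : C.CuspLabels)
    (hext : ∀ γ : ↥C.Huu ≃ₜ* ↥C.Huu, ∃ Γ : (ThetaSetting.modelχq p 1 2 even_two).PiTemp ≃ₜ*
        (ThetaSetting.modelχq p 1 2 even_two).PiTemp,
      (∀ h : C.Huu, Γ (h : (ThetaSetting.modelχq p 1 2 even_two).PiTemp) =
        ((γ h : C.Huu) : (ThetaSetting.modelχq p 1 2 even_two).PiTemp)) ∧
      (ThetaSetting.modelχq p 1 2 even_two).DeltaTemp.map Γ.toMulEquiv.toMonoidHom =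
        (ThetaSetting.modelχq p 1 2 even_two).DeltaTemp ∧
      (ThetaSetting.modelχq p 1 2 even_two).GtpYdd.map Γ.toMulEquiv.toMonoidHom =
        (ThetaSetting.modelχq p 1 2 even_two).GtpYdd)
    (h219iii : (C.thetaEnvTower τ (compat_modelχq p 1 2 even_two)
      (ThetaSetting.modelχq_sec2Hyps p 1 2 even_two)).Cor219_iii) :
    (C.thetaEnvTower τ (compat_modelχq p 1 2 even_two)
      (ThetaSetting.modelχq_sec2Hyps p 1 2 even_two)).Cor218_iv_bijective_of_odd :=
  C.cor218_iv_bijective_of_odd_of_model_of_core5_facts τ _ _ (prop15iii_etaleThetaDataχqInr p _)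
    (prop15ii_etaleThetaDataχqInr p _) L (isSlimGroup_piTemp_modelχq p 1 2 even_two) (isOpenMap_aug_modelχq p 1 2 even_two)
    (fun e => C.rigidData_core5_of_extends (τ.mod e) _ _ _ L hext) h219iii
    (ThetaSetting.modelχq_isEtThOrigin p 1 2 even_two) (hYcl_modelχq p 1 2 even_two)

/-- **THE §2 TOWER ROWS OF TRANCHES 147–154 AT THE DATUM OF RECORD, LABEL-FREE RESIDUAL** (every `X̲̲`-choice `C`,
tower `τ`, level `M`, ANY labelling `L`): given `hext` (every topological automorphism of `Π^tp_X̲̲` extends to one of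
`Π^tp_X` stabilising `Δ^tp_X`, `Π^tp_Ÿ`) and `ThetaEnvTower.Cor219_iii`, the model tower of `etaleThetaDataχqInr p`
satisfies Cor. 2.18 (iv) surjectivity at every `M`, Cor. 2.18 (iv) odd bijectivity and Cor. 2.19 (ii) — and Cor. 2.16,
Cor. 2.18 (iv) reduction, Prop. 2.14 (ii), Cor. 2.18 (ii), Cor. 2.18 (iv) fibre hold outright (§1, p453594).
[cite: MochizukiEtTh2009, Cor 2.19 (ii) p.64] -/
theorem sec2_tower_rows_modelTate_inr_of_extends (M : ℕ+) (L : C.CuspLabels)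
    (hext : ∀ γ : ↥C.Huu ≃ₜ* ↥C.Huu, ∃ Γ : (ThetaSetting.modelχq p 1 2 even_two).PiTemp ≃ₜ*
        (ThetaSetting.modelχq p 1 2 even_two).PiTemp,
      (∀ h : C.Huu, Γ (h : (ThetaSetting.modelχq p 1 2 even_two).PiTemp) =
        ((γ h : C.Huu) : (ThetaSetting.modelχq p 1 2 even_two).PiTemp)) ∧
      (ThetaSetting.modelχq p 1 2 even_two).DeltaTemp.map Γ.toMulEquiv.toMonoidHom =
        (ThetaSetting.modelχq p 1 2 even_two).DeltaTemp ∧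
      (ThetaSetting.modelχq p 1 2 even_two).GtpYdd.map Γ.toMulEquiv.toMonoidHom =
        (ThetaSetting.modelχq p 1 2 even_two).GtpYdd)
    (h219iii : (C.thetaEnvTower τ (compat_modelχq p 1 2 even_two)
      (ThetaSetting.modelχq_sec2Hyps p 1 2 even_two)).Cor219_iii) :
    (C.rigidData (τ.modAll M) (compat_modelχq p 1 2 even_two) (ThetaSetting.modelχq_sec2Hyps p 1 2 even_two)
        (prop15iii_etaleThetaDataχqInr p _) L).Cor218_iv_surjective ∧
    (C.thetaEnvTower τ (compat_modelχq p 1 2 even_two)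
        (ThetaSetting.modelχq_sec2Hyps p 1 2 even_two)).Cor218_iv_bijective_of_odd ∧
    (C.thetaEnvTower τ (compat_modelχq p 1 2 even_two) (ThetaSetting.modelχq_sec2Hyps p 1 2 even_two)).Cor219_ii :=
  ⟨rigidData_cor218_iv_surjective_modAll_modelTate_inr_of_extends p C τ M L hext h219iii,
    cor218_iv_bijective_of_odd_modelTate_inr_of_extends p C τ L hext h219iii,
    cor219_ii_modelTate_inr_of_extends p C τ L hext h219iii⟩

end Literature.AnabelianGeometry.EtaleTheta.SettingModel

end
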